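import Literature.Computability.QuantumComplexity.CleanXorAbstract
import Literature.Computability.QuantumComplexity.CoreDescBlockFP
import Literature.Computability.Complexity.CodeFPStrings
import Literature.Computability.Complexity.CodeFPLists
import HarnessLib

/-!
# The suffix layer, the wire count of the compute block and the XOR layer of a clean classical block, on codes

Topic `Computability/QuantumComplexity`, sequel of `CleanXorAbstract.lean` (the abstract gate list of
`CleanXor.circuit` = relabelled clean block `P`, XOR layer `xorOpsN`, `P` reversed; `cleanOps = notsV ++ cleanOps […] ++
notsV`) towards the uniformity of the Regev sampler's classical blocks (`Y ⊕= wordY(X)` etc.), in the typed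
polynomial-time-on-codes currency (`CodeFP`, abstract words `rawE clopE` / `rawE agE0`):

* `RevClean.notsV_eq_flatMap`, **`RevClean.notsV_codeFP`** — the suffix layer `notsV n₀ v` (a `NOT` behind the data
  on every `1` of the constant suffix `v`) from `(n₀, v)` (`v` as a string);
* **`RevSim.NN_codeFP`** — the wire count `NN e M n = n + ancN(n)` of the compute block of Bennett's trick, an explicit
  polynomial in `n` and `T(n) = (n+2)^e`, from `1ⁿ`;
* `CleanXor.xorOpsN_eq`, **`CleanXor.xorOpsN_codeFP_of`** — the XOR layer (for `j < m` and every output-letter code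
  `a`, `CNOT (base + (resW (n₀+|v|) j a − n₀)) (tpos j)`) from a context computing `n₀`, `n₀ + |v|` (unary), `base`,
  `m` (unary) and the target map `tpos`;
* `progA` versions `notsA_codeFP`, `xorA_codeFP_of` (`AJLCore.progA_fp`).

With `OpBitsAbstract.lean` (`RevClean.cleanWordA_map_codeFP`: the middle word `progA (cleanOps e M N [])`) these are
all the ingredients of the classical blocks' abstract words. Everything is proved; no named fact is introduced.

## References

* C. H. Bennett, *Logical reversibility of computation*, IBM J. Res. Dev. 17 (1973), §2 [Bennett1973].
* S. Arora, B. Barak, *Computational Complexity: A Modern Approach*, CUP 2009, §6.2 Def. 6.12 / Remark 6.7, §1.3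
  [AroraBarak2009].
* M. A. Nielsen, I. L. Chuang, *Quantum Computation and Quantum Information*, CUP 2010, §3.2.5 [NielsenChuang2010].
-/

noncomputable section

namespace Literature.Computability.QuantumComplexity

open _root_.Computability Complexity Complexity.CodeFP Cryptography Turing RevSim RevClean RevDesc AJLCore ClassicalWrap

/-! ### The suffix layer -/

/-- A filtered map is a flat map of singletons and empties. [folklore] -/
theorem RevClean.filter_map_eq_flatMap {α β : Type} (l : List α) (p : α → Bool) (f : α → β) :
    (l.filter p).map f = l.flatMap fun a => if p a then [f a] else [] := by
  induction l with
  | nil => rfl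
  | cons a l ih =>
    rw [List.filter_cons, List.flatMap_cons, ← ih]
    cases p a <;> simp

/-- The suffix layer as a flat map over the positions of `v`. [folklore] -/
theorem RevClean.notsV_eq_flatMap (n₀ : ℕ) (v : List Bool) :
    notsV n₀ v = (List.range v.length).flatMap fun i => if v.getD i false then [ClOp.not (n₀ + i)] else [] :=
  filter_map_eq_flatMap _ _ _

/-- **The suffix layer on codes**: input `(n₀, v)`, `v` as a string. [cite: Bennett1973, §2] [cite: AroraBarak2009, §6.2] -/
theorem RevClean.notsV_codeFP : CodeFP (pairE natE strE) (rawE clopE) (fun p => notsV p.1 p.2) := by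
  have hitem : CodeFP (pairE (pairE natE strE) natE) (rawE clopE)
      (fun c => if c.1.2.getD c.2 false then [ClOp.not (c.1.1 + c.2)] else []) :=
    (strGetDNat.comp ((fst _ _).snd'.pair (snd _ _)) :).ite
      (clopList1 (clop_not (natAdd.comp ((fst _ _).fst'.pair (snd _ _)) :))) (const _ [])
  have h : CodeFP (pairE natE strE) (rawE (rawE clopE))
      (fun p => (List.range p.2.length).map fun i => if p.2.getD i false then [ClOp.not (p.1 + i)] else []) :=
    ((map hitem).comp ((CodeFP.id _).pair (urange.comp (strLength.comp (snd _ _)))) :)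
  exact ((flatten clopE).comp h).congr fun p => by rw [notsV_eq_flatMap]; rfl

/-- Context-generic form. [folklore] -/
theorem RevClean.notsV_codeFP_of {σ : Type} {eσ : σ → List Bool} {n₀ : σ → ℕ} {v : σ → List Bool}
    (hn₀ : CodeFP eσ natE n₀) (hv : CodeFP eσ strE v) : CodeFP eσ (rawE clopE) (fun c => notsV (n₀ c) (v c)) :=
  (notsV_codeFP.comp (hn₀.pair hv) :)

/-- The abstract word of the suffix layer on codes. [cite: AroraBarak2009, §6.2] -/
theorem RevClean.notsA_codeFP_of {σ : Type} {eσ : σ → List Bool} {n₀ : σ → ℕ} {v : σ → List Bool}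
    (hn₀ : CodeFP eσ natE n₀) (hv : CodeFP eσ strE v) : CodeFP eσ (rawE agE0) (fun c => progA (notsV (n₀ c) (v c))) :=
  (progA_fp.comp (notsV_codeFP_of hn₀ hv) :)

/-! ### The wire count of the compute block -/

/-- **`n ↦ NN e M n` on codes from `1ⁿ`** (`NN = n + T·PP + LW + 1`, `PP = LW + RW`, `LW = nC + (Sn + d)·CW`,
`Sn = n + d·T + 2d`, `T = (n+2)^e`). [cite: Bennett1973, §2] [cite: AroraBarak2009, §1.3] -/
theorem RevSim.NN_codeFP (e : ℕ) (M : TM2ComputableAux Bool Bool) : CodeFP unE natE (NN e M) := by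
  have hn : CodeFP unE natE (fun n => n) := natOfUn
  have hT : CodeFP unE natE (fun n => Tn e n) := (natPow.comp ((natAdd.comp (hn.pair (const unE 2)) :).pair (const unE e)) :)
  have hS : CodeFP unE natE (fun n => Sn M.tm e n) :=
    (natAdd.comp ((natAdd.comp (hn.pair (natMul.comp ((const unE (dd M.tm)).pair hT)))).pair (const unE (2 * dd M.tm))) :)
  have hLW : CodeFP unE natE (fun n => LW M.tm e n) :=
    (natAdd.comp ((const unE (nC M.tm)).pair (natMul.comp ((natAdd.comp (hS.pair (const unE (dd M.tm)))).pair (const unE (CW M.tm))))) :)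
  have hPP : CodeFP unE natE (fun n => PP M.tm e n) := (natAdd.comp (hLW.pair (const unE (RW M.tm))) :)
  have hanc : CodeFP unE natE (fun n => ancN M.tm e n) :=
    (natAdd.comp ((natAdd.comp ((natMul.comp (hT.pair hPP)).pair hLW)).pair (const unE 1)) :)
  exact (natAdd.comp (hn.pair hanc) :)

/-! ### The XOR layer -/

namespace CleanXor

variable (e : ℕ) (M : TM2ComputableAux Bool Bool)

/-- The XOR layer over the listed output-letter code numbers. [folklore] -/
theorem xorOpsN_eq (n₀ : ℕ) (v : List Bool) (base m : ℕ) (tpos : ℕ → ℕ) :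
    xorOpsN e M n₀ v base m tpos = (List.range m).flatMap fun j =>
      ((trueCodes M).map fun a => (eA M a : ℕ)).map fun x =>
        ClOp.cnot (base + (NN e M (n₀ + v.length) + (j * A₁ M + x) - n₀)) (tpos j) := by
  simp only [xorOpsN, resW, List.map_map]
  rfl

variable {e M}

/-- **The XOR layer on codes** from a context computing `n₀` (binary), `n₀ + |v|` (unary), `base` (binary), `m`
(unary) and the target map. [cite: NielsenChuang2010, §3.2.5] [cite: AroraBarak2009, §6.2] -/
theorem xorOpsN_codeFP_of {σ : Type} {eσ : σ → List Bool} {n₀ base m : σ → ℕ} {v : σ → List Bool} {tpos : σ → ℕ → ℕ}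
    (hn₀ : CodeFP eσ natE n₀) (hN : CodeFP eσ unE (fun c => n₀ c + (v c).length)) (hbase : CodeFP eσ natE base)
    (hm : CodeFP eσ unE m) (htpos : CodeFP (pairE eσ natE) natE (fun q => tpos q.1 q.2)) :
    CodeFP eσ (rawE clopE) (fun c => xorOpsN e M (n₀ c) (v c) (base c) (m c) (tpos c)) := by
  have hNN : CodeFP eσ natE (fun c => NN e M (n₀ c + (v c).length)) := ((NN_codeFP e M).comp hN :)
  have hc : CodeFP (pairE (pairE eσ natE) natE) eσ (fun t => t.1.1) := (fst _ _).fst'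
  have hj : CodeFP (pairE (pairE eσ natE) natE) natE (fun t => t.1.2) := (fst _ _).snd'
  have hx : CodeFP (pairE (pairE eσ natE) natE) natE (fun t => t.2) := snd _ _
  have hgate : CodeFP (pairE (pairE eσ natE) natE) clopE
      (fun t => ClOp.cnot (base t.1.1 + (NN e M (n₀ t.1.1 + (v t.1.1).length) + (t.1.2 * A₁ M + t.2) - n₀ t.1.1)) (tpos t.1.1 t.1.2)) :=
    clop_cnot
      (natAdd.comp ((hbase.comp hc).pair (natSub.comp ((natAdd.comp ((hNN.comp hc).pair
        (natAdd.comp ((natMul.comp (hj.pair (const _ (A₁ M)))).pair hx)))).pair (hn₀.comp hc)))) :)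
      (htpos.comp (fst _ _) :)
  have hrow : CodeFP (pairE eσ natE) (rawE clopE)
      (fun q => ((trueCodes M).map fun a => (eA M a : ℕ)).map fun x =>
        ClOp.cnot (base q.1 + (NN e M (n₀ q.1 + (v q.1).length) + (q.2 * A₁ M + x) - n₀ q.1)) (tpos q.1 q.2)) :=
    ((map hgate).comp ((CodeFP.id _).pair (const _ ((trueCodes M).map fun a => (eA M a : ℕ)))) :)
  have h : CodeFP eσ (rawE (rawE clopE)) (fun c => (List.range (m c)).map fun j =>
      ((trueCodes M).map fun a => (eA M a : ℕ)).map fun x =>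
        ClOp.cnot (base c + (NN e M (n₀ c + (v c).length) + (j * A₁ M + x) - n₀ c)) (tpos c j)) :=
    ((map hrow).comp ((CodeFP.id _).pair (urange.comp hm)) :)
  exact ((flatten clopE).comp h).congr fun c => by rw [xorOpsN_eq]; rfl

/-- The abstract word of the XOR layer on codes. [cite: AroraBarak2009, §6.2] -/
theorem xorA_codeFP_of {σ : Type} {eσ : σ → List Bool} {n₀ base m : σ → ℕ} {v : σ → List Bool} {tpos : σ → ℕ → ℕ}
    (hn₀ : CodeFP eσ natE n₀) (hN : CodeFP eσ unE (fun c => n₀ c + (v c).length)) (hbase : CodeFP eσ natE base)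
    (hm : CodeFP eσ unE m) (htpos : CodeFP (pairE eσ natE) natE (fun q => tpos q.1 q.2)) :
    CodeFP eσ (rawE agE0) (fun c => progA (xorOpsN e M (n₀ c) (v c) (base c) (m c) (tpos c))) :=
  (progA_fp.comp (xorOpsN_codeFP_of hn₀ hN hbase hm htpos) :)

end CleanXor

end Literature.Computability.QuantumComplexity

end
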